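import Summits.FinalStateConjecture.FinalStateConjecture.Theorems.ExactKerrEndsSettlingAlongCensoredKerrEndsGaugeBorneUpgrade
import Literature.Geometry.Lorentzian.ExactKerrEnd
import HarnessLib

/-!
# Crux `SettlingAlongCensoredKerrEnds` (stmt-FinalStateConjecture-18520) NEEDS ONLY TAME CURVES:
# injectivity and immersion of the settled witness curve are gauge-borne

The crux C₂ of route ExactKerrEnds asks, along every tame curve `F` of admissible data whose members off
`0` are Kerr-ended and censored (immersed-injective, or constant), for a tame, INJECTIVE, IMMERSED curve
`F'` of admissible data through `F 0` whose members off `0` are settled (the Statement's settling clause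
for every maximal development). This file removes the two gauge conditions from the obligation:

  `settlingAlongCensoredKerrEnds_of_tameCurves : TameSettledCurves → SettlingAlongCensoredKerrEnds`,

where `TameSettledCurves` (displayed verbatim as the hypothesis) asks, under the hypotheses of the crux
(Kerr-endedness in the form `HasExactKerrEnd`, `InitialDataSet.hasExactKerrEnd_iff`), merely for SOME
tame curve `H` of admissible data with `H 0 = F 0` whose members off `0` are settled — no injectivity,
no immersion: the injective immersed witness is then the landed stub GU `stub_gaugeBorneUpgrade` of
line `wall-cone-sections` (gauged family of `H`: breathing of the quadratically reparametrised curve).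
Every line of C₂ (wall-cone-sections' ray over the walls, kerr-ended-attraction's kicked sections) may
therefore end in any tame curve.

References: Christodoulou, CQG 16 (1999) A23, p. A24; Dafermos–Luk 2017, Conj. 1; Lee 2013, Prop. 2.25.
-/

-- the doubled `FinalStateConjecture.FinalStateConjecture` path component trips dupNamespace
set_option linter.dupNamespace false

noncomputable section

open Set Function Filter TopologicalSpace
open scoped Manifold ContDiff Topology

namespace Summit.FinalStateConjecture.FinalStateConjecture.Theorems.ExactKerrEnds

open Literature.Geometry.Lorentzian

/-- **C₂ needs only tame curves**: if along every tame curve `F` of admissible data, immersed-injective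
or constant, whose members off `0` are Kerr-ended and censored there is SOME tame curve `H` of
admissible data with `H 0 = F 0` whose members off `0` are settled, then `SettlingAlongCensoredKerrEnds`
holds — the injective immersed witness is the gauge-borne upgrade `stub_gaugeBorneUpgrade` of `H`.
[cite: Christodoulou1999, p. A24] -/
theorem settlingAlongCensoredKerrEnds_of_tameCurves :
    (∀ (X : Type) [TopologicalSpace X] [ChartedSpace E3 X] [IsManifold (𝓡 3) ∞ X] [T2Space X]
      [SecondCountableTopology X] [ConnectedSpace X],
      ∀ (e : AFEnd X) (F : EuclideanSpace ℝ (Fin 1) → InitialDataSet (𝓡 3) X),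
        InitialDataSet.IsTameDataFamily e 1 F →
          ((InitialDataSet.IsImmersedAtZero 1 F ∧ Injective F) ∨ ∀ c, F c = F 0) →
            (∀ c, F c ∈ admissibleVacuumData X) →
              (∀ c ≠ 0, (F c).HasExactKerrEnd ∧
                ∀ 𝒟 : VacuumCauchyDevelopment (F c), 𝒟.IsMaximal →
                  Summit.FinalStateConjecture.HasCompleteNullInfinity 𝒟.toCauchyDevelopment) →
                ∃ (e' : AFEnd X) (H : EuclideanSpace ℝ (Fin 1) → InitialDataSet (𝓡 3) X),
                  InitialDataSet.IsTameDataFamily e' 1 H ∧ H 0 = F 0 ∧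
                    (∀ c, H c ∈ admissibleVacuumData X) ∧
                      ∀ c ≠ 0, ∀ 𝒟 : VacuumCauchyDevelopment (H c), 𝒟.IsMaximal →
                        Summit.FinalStateConjecture.HasCompleteNullInfinity 𝒟.toCauchyDevelopment ∧
                          ∃ (O : Set 𝒟.carrier) (d : FinalStateDecomposition 𝒟.toSpacetime O 2),
                            (∀ i, Kerr.IsSubextremal (d.mass i) (d.spin i)) ∧
                              O = Summit.FinalStateConjecture.exteriorOf 𝒟.toCauchyDevelopment
                                    d.charted ∧
                                Summit.FinalStateConjecture.RaysStayInClosure 𝒟.toCauchyDevelopment O ∧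
                                  Summit.FinalStateConjecture.HasExhaustiveCharts d ∧
                                    Summit.FinalStateConjecture.IsFutureOriented d) →
      Summit.FinalStateConjecture.FinalStateConjecture.Theses.ExactKerrEnds.SettlingAlongCensoredKerrEnds := by
  intro hT X _ _ _ _ _ _ KerrEnded Censored Settled e F hF hdich h𝓓 hQ
  -- the members off `0` of `F` are Kerr-ended (legend = `HasExactKerrEnd`, definitionally) and censored
  have hQ' : ∀ c ≠ 0, (F c).HasExactKerrEnd ∧
      ∀ 𝒟 : VacuumCauchyDevelopment (F c), 𝒟.IsMaximal →
        Summit.FinalStateConjecture.HasCompleteNullInfinity 𝒟.toCauchyDevelopment := fun c hc ↦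
    ⟨(InitialDataSet.hasExactKerrEnd_iff (F c)).2 (hQ c hc).1, (hQ c hc).2⟩
  -- a tame curve of admissible data through `F 0`, settled off `0`
  obtain ⟨e', H, hH, hH0, hHadm, hHgood⟩ := hT X e F hF hdich h𝓓 hQ'
  -- GU: immersion and injectivity are gauge-borne
  obtain ⟨e'', F', hF', hF'0, hinj, himm, hadm', hgood'⟩ := stub_gaugeBorneUpgrade X e' H hH hHadm hHgood
  exact ⟨e'', F', hF', hF'0.trans hH0, hinj, himm, hadm', fun c hc ↦ hgood' c hc⟩

end Summit.FinalStateConjecture.FinalStateConjecture.Theorems.ExactKerrEnds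

end
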